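import Literature.NumberTheory.NumberFields.ArithmeticEquivalence
import Mathlib.GroupTheory.GroupAction.Quotient
import Mathlib.GroupTheory.Perm.Cycle.Type
import Mathlib.GroupTheory.Index
import Mathlib.GroupTheory.PGroup
import HarnessLib

/-!
# Gassmann equivalence and permutation characters (towards Perlis 1977, Theorem 3)

Topic `NumberTheory/NumberFields` (namespace `Literature.NumberTheory.NumberFields`, helper material
in the sub-namespace `Gassmann`).  Theorem-only file (no definition, no named fact; D-0026), first of
four files (`GassmannPermChar`, `GassmannTwoActions`, `GassmannKleinFour`, `GassmannSmallIndex`)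
proving the group-theoretic content of Perlis's Theorem 3 [Perlis1977, §4]: **Gassmann equivalent
subgroups of index `≤ 6` of a finite group are conjugate**
(`IsGassmannEquivalent.exists_eq_map_conj` in `GassmannSmallIndex`), used to discharge the named
fact `Perlis1977_thm3` of `ArithmeticEquivalence.lean`.

## Contents

* `Gassmann.card_conj_mem_eq` — `#{g ∈ G : g x g⁻¹ ∈ H} = #C_G(x) · #(x^G ∩ H)`;
* `IsGassmannEquivalent.card_fixedBy_quotient_eq` — Gassmann equivalent `H, H'` give the same
  permutation character: every `x` fixes as many cosets of `H` as of `H'` (the easy half of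
  Perlis's Lemma 1 [Perlis1977, §1]);
* counting lemmas for a finite group acting on a finite set used by the later files: Burnside's
  lemma in `Nat.card` form, the orbit decomposition count, orbits when there are exactly two of
  them, an element of prime order `q` fixes orbits of size `< q`, two-point orbits, subgroups of
  order two.

## References

* [Perlis1977] R. Perlis, *On the equation `ζ_K(s) = ζ_{K'}(s)`*, J. Number Theory 9 (1977),
  342–360: §1 Lemma 1 (Gassmann equivalence via coset types), §4 Theorems 2–3 (pp. 353–358).
* F. Gassmann, *Bemerkungen zu der vorstehenden Arbeit von Hurwitz*, Math. Z. 25 (1926), 124–143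
  (cited through Perlis).
-/

noncomputable section

open MulAction Subgroup
open scoped Pointwise

namespace Literature.NumberTheory.NumberFields

namespace Gassmann

/-! ### Counting conjugators -/

section ConjCount

variable {G : Type*} [Group G]

/-- **Counting conjugators into a subgroup.** For a subgroup `H` and `x ∈ G`:
`#{g ∈ G : g x g⁻¹ ∈ H} = #C_G(x) · #(x^G ∩ H)`, where `x^G ∩ H` is counted as the elements of
`H` conjugate to `x` (the fibre of `g ↦ g x g⁻¹` over each such element is a coset of the
centralizer). [folklore] -/
theorem card_conj_mem_eq [Finite G] (H : Subgroup G) (x : G) :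
    Nat.card {g : G // g * x * g⁻¹ ∈ H} =
      Nat.card (centralizer ({x} : Set G)) * Nat.card {h : H // IsConj x (h : G)} := by
  classical
  let f : {g : G // g * x * g⁻¹ ∈ H} → {h : H // IsConj x (h : G)} :=
    fun g => ⟨⟨g.1 * x * g.1⁻¹, g.2⟩, isConj_iff.mpr ⟨g.1, rfl⟩⟩
  have e1 : {g : G // g * x * g⁻¹ ∈ H} ≃ Σ h : {h : H // IsConj x (h : G)}, {g // f g = h} :=
    (Equiv.sigmaFiberEquiv f).symm
  rw [Nat.card_congr e1]
  haveI : Fintype {h : H // IsConj x (h : G)} := Fintype.ofFinite _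
  rw [Nat.card_sigma]
  have hfib : ∀ h : {h : H // IsConj x (h : G)},
      Nat.card {g // f g = h} = Nat.card (centralizer ({x} : Set G)) := by
    intro h
    obtain ⟨g₀, hg₀⟩ := isConj_iff.mp h.2
    have e2 : {g // f g = h} ≃ {g : G // g * x * g⁻¹ = (h.1 : G)} :=
      { toFun := fun g => ⟨g.1.1, by
          have := congrArg (fun k : {h : H // IsConj x (h : G)} => ((k.1 : H) : G)) g.2
          exact this⟩
        invFun := fun g => ⟨⟨g.1, by rw [g.2]; exact h.1.2⟩, by
          apply Subtype.ext; apply Subtype.ext; exact g.2⟩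
        left_inv := fun g => by rfl
        right_inv := fun g => by rfl }
    -- `g ↦ g₀⁻¹ g` is a bijection from `{g : g x g⁻¹ = h}` onto the centralizer of `x`
    have e3 : {g : G // g * x * g⁻¹ = (h.1 : G)} ≃ centralizer ({x} : Set G) :=
      { toFun := fun g => ⟨g₀⁻¹ * g, by
          rw [mem_centralizer_singleton_iff]
          have hg : g.1 * x * g.1⁻¹ = g₀ * x * g₀⁻¹ := g.2.trans hg₀.symm
          calc g₀⁻¹ * g.1 * x = g₀⁻¹ * (g.1 * x * g.1⁻¹) * g.1 := by group
            _ = g₀⁻¹ * (g₀ * x * g₀⁻¹) * g.1 := by rw [hg]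
            _ = x * (g₀⁻¹ * g.1) := by group⟩
        invFun := fun c => ⟨g₀ * (c : G), by
          have hc : (c : G) * x = x * (c : G) := mem_centralizer_singleton_iff.mp c.2
          calc g₀ * (c : G) * x * (g₀ * (c : G))⁻¹
              = g₀ * ((c : G) * x) * (c : G)⁻¹ * g₀⁻¹ := by group
            _ = g₀ * (x * (c : G)) * (c : G)⁻¹ * g₀⁻¹ := by rw [hc]
            _ = g₀ * x * g₀⁻¹ := by group
            _ = (h.1 : G) := hg₀⟩
        left_inv := fun g => Subtype.ext (by simp)
        right_inv := fun c => Subtype.ext (by simp) }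
    rw [Nat.card_congr e2, Nat.card_congr e3]
  simp only [hfib, Finset.sum_const, Finset.card_univ, smul_eq_mul, Nat.card_eq_fintype_card,
    mul_comm]

/-- The same count with `g⁻¹ x g`. [folklore] -/
theorem card_inv_conj_mem_eq [Finite G] (H : Subgroup G) (x : G) :
    Nat.card {g : G // g⁻¹ * x * g ∈ H} =
      Nat.card (centralizer ({x} : Set G)) * Nat.card {h : H // IsConj x (h : G)} := by
  rw [← card_conj_mem_eq H x]
  refine Nat.card_congr ⟨fun g => ⟨g.1⁻¹, by simpa using g.2⟩, fun g => ⟨g.1⁻¹, by simpa using g.2⟩,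
    fun g => Subtype.ext (inv_inv g.1), fun g => Subtype.ext (inv_inv g.1)⟩

end ConjCount

/-! ### The permutation character of `G` on `G ⧸ H` -/

section PermChar

variable {G : Type*} [Group G]

/-- `#Fix_{G/H}(x) · #H = #{g : g⁻¹ x g ∈ H}`: the coset `gH` is fixed by `x` iff `g⁻¹ x g ∈ H`.
[folklore] -/
theorem card_fixedBy_quotient_mul_card (H : Subgroup G) (x : G) :
    Nat.card (fixedBy (G ⧸ H) x) * Nat.card H = Nat.card {g : G // g⁻¹ * x * g ∈ H} := by
  have e1 : {g : G // g⁻¹ * x * g ∈ H} ≃ (QuotientGroup.mk ⁻¹' fixedBy (G ⧸ H) x : Set G) := by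
    refine Equiv.subtypeEquivRight fun g => ?_
    rw [Set.mem_preimage, mem_fixedBy, MulAction.Quotient.smul_mk, QuotientGroup.eq, smul_eq_mul,
      mul_inv_rev, ← inv_mem_iff (x := g⁻¹ * x * g)]
    simp [mul_assoc]
  rw [Nat.card_congr e1, Nat.card_congr (QuotientGroup.preimageMkEquivSubgroupProdSet H _),
    Nat.card_prod, mul_comm]

/-- **Gassmann equivalence is equality of permutation characters**: if `H, H'` are Gassmann
equivalent in the finite group `G` then every `x ∈ G` has as many fixed points on `G/H` as on
`G/H'` (both equal `#C_G(x) · #(x^G ∩ H) / #H`, and `#H = #H'`).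
[cite: Perlis1977, §1 Lemma 1 (proof)] -/
theorem _root_.Literature.NumberTheory.NumberFields.IsGassmannEquivalent.card_fixedBy_quotient_eq
    [Finite G] {H H' : Subgroup G} (h : IsGassmannEquivalent H H')
    (x : G) : Nat.card (fixedBy (G ⧸ H) x) = Nat.card (fixedBy (G ⧸ H') x) := by
  have h1 := card_fixedBy_quotient_mul_card H x
  have h2 := card_fixedBy_quotient_mul_card H' x
  rw [card_inv_conj_mem_eq, h x] at h1
  rw [card_inv_conj_mem_eq, ← h.card_eq] at h2
  have hpos : 0 < Nat.card H := Nat.card_pos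
  exact Nat.eq_of_mul_eq_mul_right hpos (h1.trans h2.symm)

end PermChar

/-! ### Auxiliary counting lemmas for finite group actions -/

section Helpers

variable {S : Type*} [Group S] {Y : Type*} [MulAction S Y]

/-- Two points have the same class in the orbit quotient iff they lie in the same orbit.
[folklore] -/
theorem mk_eq_mk_iff {a b : Y} :
    (Quotient.mk'' a : orbitRel.Quotient S Y) = Quotient.mk'' b ↔ a ∈ orbit S b := by
  rw [← orbitRel.Quotient.mem_orbit, orbitRel.Quotient.orbit_mk]

/-- A type with three distinct elements has at least three elements. [folklore] -/
theorem three_le_card {α : Type*} [Finite α] {a b c : α} (hab : a ≠ b) (hac : a ≠ c)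
    (hbc : b ≠ c) : 3 ≤ Nat.card α := by
  have h : ({a, b, c} : Set α).ncard = 3 := Set.ncard_eq_three.mpr ⟨a, b, c, hab, hac, hbc, rfl⟩
  rw [← h, ← Set.ncard_univ]
  exact Set.ncard_le_ncard (Set.subset_univ _)

/-- A type with four distinct elements has at least four elements. [folklore] -/
theorem four_le_card {α : Type*} [Finite α] {a b c d : α} (hab : a ≠ b) (hac : a ≠ c)
    (had : a ≠ d) (hbc : b ≠ c) (hbd : b ≠ d) (hcd : c ≠ d) : 4 ≤ Nat.card α := by
  have h3 : ({b, c, d} : Set α).ncard = 3 := Set.ncard_eq_three.mpr ⟨b, c, d, hbc, hbd, hcd, rfl⟩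
  have h4 : ({a, b, c, d} : Set α).ncard = 4 := by
    rw [Set.ncard_insert_of_notMem (by simp [hab, hac, had]), h3]
  rw [← h4, ← Set.ncard_univ]
  exact Set.ncard_le_ncard (Set.subset_univ _)

/-- **Burnside's lemma**, `Nat.card` form: `Σ_{s ∈ S} #Fix(s) = #(orbits) · #S`. [folklore] -/
theorem finsum_card_fixedBy_eq [Finite S] [Finite Y] :
    ∑ᶠ s : S, Nat.card (fixedBy Y s) = Nat.card (orbitRel.Quotient S Y) * Nat.card S := by
  classical
  letI := Fintype.ofFinite S
  letI := Fintype.ofFinite Y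
  rw [finsum_eq_sum_of_fintype, Nat.card_eq_fintype_card (α := S),
    Nat.card_eq_fintype_card (α := orbitRel.Quotient S Y)]
  simp_rw [Nat.card_eq_fintype_card]
  exact MulAction.sum_card_fixedBy_eq_card_orbits_mul_card_group S Y

/-- The orbit decomposition, counted: `#Y = Σ_{orbits ω} #ω`. [folklore] -/
theorem card_eq_sum_ncard_orbit [Finite Y] [Fintype (orbitRel.Quotient S Y)] :
    Nat.card Y = ∑ ω : orbitRel.Quotient S Y, ω.orbit.ncard := by
  rw [Nat.card_congr (selfEquivSigmaOrbits' S Y), Nat.card_sigma]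
  simp_rw [Nat.card_coe_set_eq]

/-- If every orbit has at least two points and there are `r` orbits, then any one orbit has at
most `#Y - 2(r-1)` points. [folklore] -/
theorem ncard_orbit_add_le [Finite Y] (h2 : ∀ y : Y, 2 ≤ (orbit S y).ncard) (y : Y) :
    (orbit S y).ncard + 2 * (Nat.card (orbitRel.Quotient S Y) - 1) ≤ Nat.card Y := by
  classical
  letI : Fintype (orbitRel.Quotient S Y) := Fintype.ofFinite _
  have hsum := card_eq_sum_ncard_orbit (S := S) (Y := Y)
  set ω₀ : orbitRel.Quotient S Y := Quotient.mk'' y with hω₀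
  rw [← Finset.add_sum_erase Finset.univ _ (Finset.mem_univ ω₀)] at hsum
  have h0 : ω₀.orbit.ncard = (orbit S y).ncard := by rw [hω₀, orbitRel.Quotient.orbit_mk]
  have hrest : (Finset.univ.erase ω₀).card • 2 ≤
      ∑ ω ∈ Finset.univ.erase ω₀, ω.orbit.ncard := by
    apply Finset.card_nsmul_le_sum
    intro ω _
    induction ω using Quotient.inductionOn' with
    | h z => rw [orbitRel.Quotient.orbit_mk]; exact h2 z
  rw [Finset.card_erase_of_mem (Finset.mem_univ _), Finset.card_univ, ← Nat.card_eq_fintype_card,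
    smul_eq_mul] at hrest
  omega

/-- With exactly two orbits, the orbit of a point outside a given orbit is its complement.
[folklore] -/
theorem orbit_eq_compl_of_card_quotient [Finite Y] (hr : Nat.card (orbitRel.Quotient S Y) = 2)
    {y z : Y} (hz : z ∉ orbit S y) : orbit S z = (orbit S y)ᶜ := by
  ext w
  simp only [Set.mem_compl_iff]
  constructor
  · intro hw hw'
    apply hz
    have e1 : orbit S w = orbit S z := orbit_eq_iff.mpr hw
    have e2 : orbit S w = orbit S y := orbit_eq_iff.mpr hw'
    rw [← orbit_eq_iff, ← e1, e2]
  · intro hw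
    by_contra hwz
    have h3 := three_le_card (α := orbitRel.Quotient S Y) (a := Quotient.mk'' y)
      (b := Quotient.mk'' z) (c := Quotient.mk'' w)
      (fun h => hz (mem_orbit_symm.mp (mk_eq_mk_iff.mp h)))
      (fun h => hw (mem_orbit_symm.mp (mk_eq_mk_iff.mp h)))
      (fun h => hwz (mem_orbit_symm.mp (mk_eq_mk_iff.mp h)))
    omega

/-- An element of prime order `q` fixes every point whose orbit (under the whole group) has
fewer than `q` points. [folklore] -/
theorem smul_eq_of_ncard_orbit_lt [Finite Y] {s : S} {q : ℕ} (hq : q.Prime) (hs : orderOf s = q)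
    (y : Y) (hlt : (orbit S y).ncard < q) : s • y = y := by
  classical
  have hdvd : Function.minimalPeriod (s • ·) y ∣ q := by
    rw [← MulAction.pow_smul_eq_iff_minimalPeriod_dvd, ← hs, pow_orderOf_eq_one, one_smul]
  rcases hq.eq_one_or_self_of_dvd _ hdvd with h1 | h1
  · exact Function.minimalPeriod_eq_one_iff_isFixedPt.mp h1
  · exfalso
    have hinj := Function.iterate_injOn_Iio_minimalPeriod (f := (s • ·)) (x := y)
    rw [h1] at hinj
    have hinj' : Set.InjOn (fun k : ℕ => s ^ k • y) (Finset.range q : Set ℕ) := by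
      intro a ha b hb hab
      refine hinj (by simpa using ha) (by simpa using hb) ?_
      simp only [smul_iterate]
      exact hab
    have hsub : (((Finset.range q).image fun k => s ^ k • y : Finset Y) : Set Y) ⊆ orbit S y := by
      intro w hw
      rw [Finset.coe_image] at hw
      obtain ⟨k, -, rfl⟩ := hw
      exact mem_orbit y (s ^ k)
    have hle := Set.ncard_le_ncard hsub
    rw [Set.ncard_coe_finset, Finset.card_image_of_injOn hinj', Finset.card_range] at hle
    omega

/-- An element fixing one point of a two-point orbit fixes the orbit pointwise. [folklore] -/
theorem smul_eq_of_ncard_orbit_eq_two [Finite Y] {s : S} {y : Y} (h2 : (orbit S y).ncard = 2)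
    (hy : s • y = y) {w : Y} (hw : w ∈ orbit S y) : s • w = w := by
  by_contra hne
  have hwy : w ≠ y := by rintro rfl; exact hne hy
  have hsw : s • w ∈ orbit S y := by
    rw [← orbit_eq_iff.mpr hw]; exact mem_orbit w s
  have hswy : s • w ≠ y := by
    intro h; apply hwy; rw [← hy] at h; exact smul_left_cancel s h
  have hlt : 2 < (orbit S y).ncard :=
    (Set.two_lt_ncard_iff).mpr ⟨y, w, s • w, mem_orbit_self y, hw, hsw, hwy.symm, hswy.symm,
      fun h => hne h.symm⟩
  omega

/-- The square of any element acts trivially on a two-point orbit. [folklore] -/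
theorem smul_smul_eq_of_ncard_orbit_eq_two [Finite Y] (s : S) {y : Y}
    (h2 : (orbit S y).ncard = 2) : s • s • y = y := by
  by_cases hy : s • y = y
  · rw [hy, hy]
  · by_contra hne
    have h1 : s • y ∈ orbit S y := mem_orbit y s
    have h1' : s • s • y ∈ orbit S y := by rw [smul_smul]; exact mem_orbit y (s * s)
    have hne2 : s • s • y ≠ s • y := fun h => hy (smul_left_cancel s h)
    have hlt : 2 < (orbit S y).ncard :=
      (Set.two_lt_ncard_iff).mpr ⟨y, s • y, s • s • y, mem_orbit_self y, h1, h1',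
        fun h => hy h.symm, fun h => hne h.symm, hne2.symm⟩
    omega

/-- In a subgroup of order two, any two nontrivial elements coincide. [folklore] -/
theorem eq_of_card_eq_two {K : Subgroup S} (hK : Nat.card K = 2) {a b : S} (ha : a ∈ K)
    (hb : b ∈ K) (ha1 : a ≠ 1) (hb1 : b ≠ 1) : a = b := by
  by_contra hab
  haveI : Finite K := Nat.finite_of_card_ne_zero (by rw [hK]; norm_num)
  have := three_le_card (α := K) (a := (1 : K)) (b := ⟨a, ha⟩) (c := ⟨b, hb⟩)
    (fun h => ha1 (congrArg Subtype.val h).symm) (fun h => hb1 (congrArg Subtype.val h).symm)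
    (fun h => hab (congrArg Subtype.val h))
  omega

end Helpers

end Gassmann

end Literature.NumberTheory.NumberFields
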